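import Literature.Analysis.FunctionSpaces.SobolevBallScaling
import Literature.Analysis.FunctionSpaces.ExteriorLipschitzDomain
import HarnessLib

/-!
# The Sobolev inequality on spherical shells with a scale-invariant constant

Analysis/FunctionSpaces support file (all results proved; no named facts). The companion of
`SobolevBallScaling.lean` for **spherical shells (annuli)** `A(x₀; r, R) = {r < |x - x₀| < R}`:
for a fixed aspect ratio `θ ∈ (0, 1)` the shells `A(x₀; θρ, ρ)`, `ρ > 0`, are the dilates of the
unit shell `A(0; θ, 1)`, and the Sobolev inequality `W^{1,p}(A) ⊂ L^{p'}(A)` holds on them with a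
constant depending only on `(E, p, θ)`, in the scale-invariant form

  `‖f‖_{L^{p'}(A(x₀; θρ, ρ))} ≤ C (ρ⁻¹ ‖f‖_{L^p(A(x₀; θρ, ρ))} + ‖Df‖_{L^p(A(x₀; θρ, ρ))})`,

`1 ≤ p < n = dim E`, `1/p' = 1/p - 1/n`, `f ∈ W^{1,p}(A; F)`, `F` complete
(`exists_eLpNorm_le_shell`). This is the form in which annular (dyadic-shell) energy arguments
for the stationary Navier–Stokes system use the Gagliardo–Nirenberg–Sobolev inequality "on the
reference annulus, then rescaled" (e.g. Tsai 2021, §2; Seregin–Wang 2020, Prop. 2.1; Galdi 2011,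
§II.3 for locally Lipschitz domains).

## Proof

The open shell is a bounded Lipschitz domain: it is `B(x₀, R) ⊓ outerDomain B(x₀, r)`, a ball
with the closure of a Lipschitz domain removed (`isLipschitzDomain_ball_inf_outerDomain`,
`isLipschitzDomain_ball`; Grisvard 1985, §1.2.1) — `isLipschitzDomain_shell`. Hence the tree's
embedding `exists_eLpNorm_le_of_memSobolevDomain_one` (Adams 1975, Lemma 5.10) applies on the
unit shell `A(0; θ, 1)` with some constant `C = C(E, p, θ)`. The affine change of variables
`x = x₀ + ρ y` maps `A(0; θ, 1)` onto `A(x₀; θρ, ρ)` (`affinePreimage_shell`), and the transport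
lemmas of `SobolevBallScaling` (`HasWeakFDerivOn.comp_affine`, `MemSobolevDomain.comp_affine_one`,
`eLpNorm_comp_affine`: `‖f ∘ A‖_{L^q(A⁻¹S)} = ρ^{-n/q} ‖f‖_{L^q(S)}`, `D(f ∘ A) = ρ (Df) ∘ A`)
give the scale-invariant form exactly as for balls (`n/p - n/p' = 1`).

## References

* R. A. Adams, *Sobolev Spaces* (1975), Lemma 5.10, Thm. 5.4.
* P. Grisvard, *Elliptic problems in nonsmooth domains* (1985), §1.2.1.
* L. C. Evans, *Partial Differential Equations*, 2nd ed. (2010), §5.6.1 Thm. 2 and the scaling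
  remark.
* T.-P. Tsai, *Liouville type theorems for stationary Navier–Stokes equations*, SN PDE 2 (2021),
  §2 (annular Sobolev/Bogovskiĭ constants by scaling). [Tsai2021]
-/

noncomputable section

open MeasureTheory Set Function Filter TopologicalSpace Metric Module
open scoped NNReal ENNReal Topology

namespace Literature.Analysis.FunctionSpaces

variable {E : Type*} [NormedAddCommGroup E] [InnerProductSpace ℝ E] [FiniteDimensional ℝ E]
  [MeasurableSpace E] [BorelSpace E]
variable {F : Type*} [NormedAddCommGroup F] [NormedSpace ℝ F]

/-! ### Open spherical shells -/

/-- The open spherical shell (annulus) `A(x₀; r, R) = {x | r < dist x x₀ < R} =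
B(x₀, R) ∩ (closed B(x₀, r))ᶜ`, as an open set (Grisvard 1985, §1.2.1: a ball with a hole).
[cite: Grisvard1985, §1.2.1 (Def. 1.2.1.1)] -/
def shell (x₀ : E) (r R : ℝ) : Opens E :=
  ⟨ball x₀ R ∩ (closedBall x₀ r)ᶜ, isOpen_ball.inter isClosed_closedBall.isOpen_compl⟩

omit [InnerProductSpace ℝ E] [FiniteDimensional ℝ E] [MeasurableSpace E] [BorelSpace E] in
/-- Underlying set of the shell (Grisvard 1985, §1.2.1: a ball with a hole). [cite: Grisvard1985, §1.2.1 (Def. 1.2.1.1)] -/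
@[simp]
theorem coe_shell (x₀ : E) (r R : ℝ) :
    ((shell x₀ r R : Opens E) : Set E) = ball x₀ R ∩ (closedBall x₀ r)ᶜ := rfl

omit [InnerProductSpace ℝ E] [FiniteDimensional ℝ E] [MeasurableSpace E] [BorelSpace E] in
/-- Membership in the shell: `r < dist x x₀ < R` (Grisvard 1985, §1.2.1). [cite: Grisvard1985, §1.2.1 (Def. 1.2.1.1)] -/
theorem mem_shell_iff {x₀ x : E} {r R : ℝ} :
    x ∈ ((shell x₀ r R : Opens E) : Set E) ↔ r < dist x x₀ ∧ dist x x₀ < R := by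
  rw [coe_shell, mem_inter_iff, mem_compl_iff, mem_ball, mem_closedBall, not_le, and_comm]

omit [InnerProductSpace ℝ E] [FiniteDimensional ℝ E] [MeasurableSpace E] [BorelSpace E] in
/-- The shell centred at the origin: `r < ‖x‖ < R` (Grisvard 1985, §1.2.1). [cite: Grisvard1985, §1.2.1 (Def. 1.2.1.1)] -/
theorem mem_shell_zero_iff {x : E} {r R : ℝ} :
    x ∈ ((shell (0 : E) r R : Opens E) : Set E) ↔ r < ‖x‖ ∧ ‖x‖ < R := by
  rw [mem_shell_iff, dist_zero_right]

omit [InnerProductSpace ℝ E] [FiniteDimensional ℝ E] [MeasurableSpace E] [BorelSpace E] in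
/-- The shell is a measurable (open) set (Grisvard 1985, §1.2.1). [cite: Grisvard1985, §1.2.1 (Def. 1.2.1.1)] -/
theorem measurableSet_shell [MeasurableSpace E] [OpensMeasurableSpace E] (x₀ : E) (r R : ℝ) :
    MeasurableSet ((shell x₀ r R : Opens E) : Set E) :=
  (shell x₀ r R).isOpen.measurableSet

omit [InnerProductSpace ℝ E] [FiniteDimensional ℝ E] [MeasurableSpace E] [BorelSpace E] in
/-- The shell lies in the outer ball, hence is bounded (Grisvard 1985, §1.2.1: a bounded domain with a hole). [cite: Grisvard1985, §1.2.1 (Def. 1.2.1.1)] -/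
theorem isBounded_shell (x₀ : E) (r R : ℝ) :
    Bornology.IsBounded (((shell x₀ r R : Opens E)) : Set E) :=
  isBounded_ball.subset inter_subset_left

omit [FiniteDimensional ℝ E] [MeasurableSpace E] [BorelSpace E] in
/-- For `r > 0` the shell is the ball with the closure of the inner ball removed:
`A(x₀; r, R) = B(x₀, R) ⊓ outerDomain B(x₀, r)` (Grisvard 1985, §1.2.1). [cite: Grisvard1985, §1.2.1 (Def. 1.2.1.1)] -/
theorem shell_eq_ball_inf_outerDomain (x₀ : E) {r : ℝ} (hr : 0 < r) (R : ℝ) :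
    shell x₀ r R = (⟨ball x₀ R, isOpen_ball⟩ : Opens E) ⊓ outerDomain ⟨ball x₀ r, isOpen_ball⟩ := by
  ext x
  change x ∈ ball x₀ R ∩ (closedBall x₀ r)ᶜ ↔ x ∈ ball x₀ R ∩ (closure (ball x₀ r))ᶜ
  rw [closure_ball x₀ hr.ne']

omit [FiniteDimensional ℝ E] [MeasurableSpace E] [BorelSpace E] in
/-- **Open spherical shells are Lipschitz domains** (`0 < r < R`): `A(x₀; r, R)` is the ball
`B(x₀, R)` with the closed ball `closure B(x₀, r) ⊆ B(x₀, R)` removed, so the tree's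
`isLipschitzDomain_ball_inf_outerDomain` (with `isLipschitzDomain_ball`) applies (Grisvard 1985,
§1.2.1: the two boundary spheres are disjoint). [cite: Grisvard1985, §1.2.1 (Def. 1.2.1.1)] -/
theorem isLipschitzDomain_shell (x₀ : E) {r R : ℝ} (hr : 0 < r) (hrR : r < R) :
    IsLipschitzDomain (shell x₀ r R) := by
  rw [shell_eq_ball_inf_outerDomain x₀ hr R]
  refine isLipschitzDomain_ball_inf_outerDomain (isLipschitzDomain_ball x₀ r) ?_
  change closure (ball x₀ r) ⊆ ball x₀ R
  rw [closure_ball x₀ hr.ne']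
  exact closedBall_subset_ball hrR

omit [InnerProductSpace ℝ E] [FiniteDimensional ℝ E] [MeasurableSpace E] [BorelSpace E] in
/-- The affine preimage of a shell: `A⁻¹ A(x₀; r, R) = A(0; r/ρ, R/ρ)` for `A y = x₀ + ρ y`,
`ρ > 0` (the dilation of Evans 2010, §5.6.1, scaling remark after Thm. 2, on annuli). [cite: Evans2010, §5.6.1 Thm. 2 (scaling remark)] -/
theorem preimage_affine_shell [NormedSpace ℝ E] {ρ : ℝ} (hρ : 0 < ρ) (x₀ : E) (r R : ℝ) :
    (fun y : E => x₀ + ρ • y) ⁻¹' ((shell x₀ r R : Opens E) : Set E) =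
      ((shell (0 : E) (r / ρ) (R / ρ) : Opens E) : Set E) := by
  ext y
  rw [mem_preimage, mem_shell_iff, mem_shell_zero_iff, dist_eq_norm, add_sub_cancel_left, norm_smul,
    Real.norm_eq_abs, abs_of_pos hρ, div_lt_iff₀' hρ, lt_div_iff₀' hρ]

omit [FiniteDimensional ℝ E] [MeasurableSpace E] [BorelSpace E] in
/-- The unit shell `A(0; θ, 1)` is the affine preimage of `A(x₀; θρ, ρ)` under `y ↦ x₀ + ρ y`
(`ρ > 0`; Evans 2010, §5.6.1, scaling remark after Thm. 2). [cite: Evans2010, §5.6.1 Thm. 2 (scaling remark)] -/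
theorem affinePreimage_shell {ρ : ℝ} (hρ : 0 < ρ) (x₀ : E) (θ : ℝ) :
    affinePreimage ρ x₀ (shell x₀ (θ * ρ) ρ) = shell (0 : E) θ 1 := by
  ext y
  change y ∈ (fun y : E => x₀ + ρ • y) ⁻¹' ((shell x₀ (θ * ρ) ρ : Opens E) : Set E) ↔
    y ∈ ((shell (0 : E) θ 1 : Opens E) : Set E)
  rw [preimage_affine_shell hρ x₀, mul_div_cancel_right₀ θ hρ.ne', div_self hρ.ne']

/-! ### The Sobolev inequality on shells, scale-invariant form -/

/-- **The Sobolev inequality on spherical shells with a scale-invariant constant.** Let `E` be a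
finite-dimensional real inner product space of dimension `n`, `1 ≤ p < n`, `1/p' = 1/p - 1/n`,
`F` complete, and fix the aspect ratio `0 < θ < 1`. There is `C = C(E, p, θ)` such that for every
shell `A = A(x₀; θρ, ρ) = {θρ < |x - x₀| < ρ}`, `ρ > 0`, every `f ∈ W^{1,p}(A; F)` and every weak
derivative `g` of `f` on `A`,
`‖f‖_{L^{p'}(A)} ≤ C (ρ⁻¹ ‖f‖_{L^p(A)} + ‖g‖_{L^p(A)})`. From the unit shell `A(0; θ, 1)` — a
bounded Lipschitz domain (`isLipschitzDomain_shell`), whence the tree's embedding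
`exists_eLpNorm_le_of_memSobolevDomain_one` (Adams 1975, Lemma 5.10) — by the change of
variables `x = x₀ + ρ y` (`eLpNorm_comp_affine`, `HasWeakFDerivOn.comp_affine`,
`MemSobolevDomain.comp_affine_one`): `‖f ∘ A‖_{L^q(A₁)} = ρ^{-n/q} ‖f‖_{L^q(A)}`,
`D(f ∘ A) = ρ (Df) ∘ A`, and `n/p - n/p' = 1`; verbatim the argument of `exists_eLpNorm_le_ball`.
(Evans 2010, §5.6.1 Thm. 2 with the scaling remark; the annular form used in Tsai 2021, §2.)
[cite: Adams1975, Lemma 5.10] -/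
theorem exists_eLpNorm_le_shell [CompleteSpace F] {p p' : ℝ≥0} (hp : 1 ≤ p)
    (hpn : (p : ℝ) < finrank ℝ E) (hp' : (p' : ℝ)⁻¹ = (p : ℝ)⁻¹ - (finrank ℝ E : ℝ)⁻¹)
    {θ : ℝ} (hθ0 : 0 < θ) (hθ1 : θ < 1) :
    ∃ C : ℝ≥0, ∀ (x₀ : E) (ρ : ℝ), 0 < ρ → ∀ (f : E → F) (g : E → E →L[ℝ] F),
      MemSobolevDomain 1 (p : ℝ≥0∞) (shell x₀ (θ * ρ) ρ) volume f →
      HasWeakFDerivOn (shell x₀ (θ * ρ) ρ) volume f g →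
      eLpNorm f p' (volume.restrict ((shell x₀ (θ * ρ) ρ : Opens E) : Set E)) ≤
        C * ((ENNReal.ofReal ρ)⁻¹ * eLpNorm f p (volume.restrict ((shell x₀ (θ * ρ) ρ : Opens E) : Set E)) +
          eLpNorm g p (volume.restrict ((shell x₀ (θ * ρ) ρ : Opens E) : Set E))) := by
  set n := finrank ℝ E with hn
  obtain ⟨C, hC⟩ := exists_eLpNorm_le_of_memSobolevDomain_one (F := F)
    (isLipschitzDomain_shell (0 : E) hθ0 hθ1) (isBounded_shell (0 : E) θ 1) hp hpn hp' volume
  refine ⟨C, fun x₀ ρ hρ f g hf hg => ?_⟩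
  -- exponents
  have hp0 : (p : ℝ) ≠ 0 := by
    have h1 : (1 : ℝ) ≤ p := by exact_mod_cast hp
    exact (lt_of_lt_of_le one_pos h1).ne'
  have hn0 : (n : ℝ) ≠ 0 := by
    have : (0 : ℝ) < n := lt_of_le_of_lt (by positivity) hpn
    exact this.ne'
  have hp'0 : (p' : ℝ) ≠ 0 := by
    intro h0
    rw [h0, inv_zero] at hp'
    have h1 : (p : ℝ)⁻¹ = (n : ℝ)⁻¹ := by linarith
    have : (p : ℝ) = n := inv_injective h1
    linarith
  set a : ℝ := (n : ℝ) * (p' : ℝ)⁻¹ with ha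
  set b : ℝ := (n : ℝ) * (p : ℝ)⁻¹ with hb
  have hab : b = a + 1 := by
    rw [ha, hb, hp', mul_sub, mul_inv_cancel₀ hn0]; ring
  set Rρ : ℝ≥0∞ := ENNReal.ofReal ρ with hR
  have hR0 : Rρ ≠ 0 := (ENNReal.ofReal_pos.2 hρ).ne'
  have hRt : Rρ ≠ ⊤ := ENNReal.ofReal_ne_top
  -- transport to the unit shell
  set A : Opens E := shell x₀ (θ * ρ) ρ with hA
  set S : Set E := ((shell x₀ (θ * ρ) ρ : Opens E) : Set E) with hS
  set S₁ : Set E := ((shell (0 : E) θ 1 : Opens E) : Set E) with hS₁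
  have hpre : affinePreimage ρ x₀ A = shell (0 : E) θ 1 := affinePreimage_shell hρ x₀ θ
  have hpreS : (fun y : E => x₀ + ρ • y) ⁻¹' S = S₁ := by
    rw [hS, hS₁, preimage_affine_shell hρ x₀, mul_div_cancel_right₀ θ hρ.ne', div_self hρ.ne']
  have hf₁ : MemSobolevDomain 1 (p : ℝ≥0∞) (shell (0 : E) θ 1) volume
      (fun y => f (x₀ + ρ • y)) := hpre ▸ hf.comp_affine_one hρ x₀
  have hg₁ : HasWeakFDerivOn (shell (0 : E) θ 1) volume
      (fun y => f (x₀ + ρ • y)) (fun y => ρ • g (x₀ + ρ • y)) := hpre ▸ hg.comp_affine hρ x₀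
  have hunit := hC _ _ hf₁ hg₁
  -- the norms
  have e1 : eLpNorm (fun y => f (x₀ + ρ • y)) p' (volume.restrict S₁) =
      Rρ ^ (-a) * eLpNorm f p' (volume.restrict S) := by
    rw [← hpreS, eLpNorm_comp_affine hρ x₀ f p' S, ofReal_inv_pow_rpow hρ n p', ha, neg_mul]
  have e2 : eLpNorm (fun y => f (x₀ + ρ • y)) p (volume.restrict S₁) =
      Rρ ^ (-b) * eLpNorm f p (volume.restrict S) := by
    rw [← hpreS, eLpNorm_comp_affine hρ x₀ f p S, ofReal_inv_pow_rpow hρ n p, hb, neg_mul]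
  have e3 : eLpNorm (fun y => ρ • g (x₀ + ρ • y)) p (volume.restrict S₁) =
      Rρ * (Rρ ^ (-b) * eLpNorm g p (volume.restrict S)) := by
    have hsm := eLpNorm_const_smul ρ (fun y => g (x₀ + ρ • y)) (p : ℝ≥0∞) (volume.restrict S₁)
    rw [show (ρ • fun y => g (x₀ + ρ • y)) = fun y => ρ • g (x₀ + ρ • y) from rfl] at hsm
    rw [hsm, Real.enorm_eq_ofReal hρ.le, ← hpreS, eLpNorm_comp_affine hρ x₀ g p S,
      ofReal_inv_pow_rpow hρ n p, hb, neg_mul]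
  -- unscale
  change eLpNorm (fun y => f (x₀ + ρ • y)) (p' : ℝ≥0∞) (volume.restrict S₁) ≤
    C * (eLpNorm (fun y => f (x₀ + ρ • y)) (p : ℝ≥0∞) (volume.restrict S₁) +
      eLpNorm (fun y => ρ • g (x₀ + ρ • y)) (p : ℝ≥0∞) (volume.restrict S₁)) at hunit
  rw [e1, e2, e3] at hunit
  set X := eLpNorm f p' (volume.restrict S)
  set Y := eLpNorm f p (volume.restrict S)
  set Z := eLpNorm g p (volume.restrict S)
  have h1 : Rρ ^ a * Rρ ^ (-b) = Rρ⁻¹ := by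
    rw [← ENNReal.rpow_add _ _ hR0 hRt, show a + -b = -1 by rw [hab]; ring, ENNReal.rpow_neg_one]
  have h2 : Rρ ^ a * (Rρ * Rρ ^ (-b)) = 1 := by
    rw [show (Rρ * Rρ ^ (-b)) = Rρ ^ (1 : ℝ) * Rρ ^ (-b) by rw [ENNReal.rpow_one],
      ← ENNReal.rpow_add _ _ hR0 hRt, ← ENNReal.rpow_add _ _ hR0 hRt,
      show a + (1 + -b) = 0 by rw [hab]; ring, ENNReal.rpow_zero]
  calc X = Rρ ^ a * (Rρ ^ (-a) * X) := by
        rw [← mul_assoc, ← ENNReal.rpow_add _ _ hR0 hRt, add_neg_cancel, ENNReal.rpow_zero, one_mul]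
    _ ≤ Rρ ^ a * (C * (Rρ ^ (-b) * Y + Rρ * (Rρ ^ (-b) * Z))) :=
        mul_le_mul_of_nonneg_left hunit (by positivity)
    _ = C * (Rρ ^ a * Rρ ^ (-b) * Y + Rρ ^ a * (Rρ * Rρ ^ (-b)) * Z) := by ring
    _ = C * (Rρ⁻¹ * Y + Z) := by rw [h1, h2, one_mul]

/-- **The case `n = 3`, `p = 2`, `p' = 6` for `C¹` fields** (the form used by annular energy
arguments: `H¹(A) ⊂ L⁶(A)` on the shells `A(x₀; θρ, ρ)` of `ℝ³` with a `ρ`-independent constant):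
for `0 < θ < 1` there is `C = C(E, θ)` (`dim E = 3`) such that for every `ρ > 0`, every `x₀` and
every `C¹` map `f : E → F` whose restriction to `A = A(x₀; θρ, ρ)` lies in `L²` together with its
derivative, `‖f‖_{L⁶(A)} ≤ C (ρ⁻¹ ‖f‖_{L²(A)} + ‖Df‖_{L²(A)})` (the classical derivative is a weak
derivative, `HasWeakFDerivOn.of_contDiff_holds`). [cite: Adams1975, Lemma 5.10] -/
theorem exists_eLpNorm_six_le_shell_of_contDiff [CompleteSpace F] (h3 : finrank ℝ E = 3)
    {θ : ℝ} (hθ0 : 0 < θ) (hθ1 : θ < 1) :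
    ∃ C : ℝ≥0, ∀ (x₀ : E) (ρ : ℝ), 0 < ρ → ∀ (f : E → F), ContDiff ℝ 1 f →
      MemLp f 2 (volume.restrict ((shell x₀ (θ * ρ) ρ : Opens E) : Set E)) →
      MemLp (fderiv ℝ f) 2 (volume.restrict ((shell x₀ (θ * ρ) ρ : Opens E) : Set E)) →
      eLpNorm f 6 (volume.restrict ((shell x₀ (θ * ρ) ρ : Opens E) : Set E)) ≤
        C * ((ENNReal.ofReal ρ)⁻¹ * eLpNorm f 2 (volume.restrict ((shell x₀ (θ * ρ) ρ : Opens E) : Set E)) +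
          eLpNorm (fderiv ℝ f) 2 (volume.restrict ((shell x₀ (θ * ρ) ρ : Opens E) : Set E))) := by
  obtain ⟨C, hC⟩ := exists_eLpNorm_le_shell (E := E) (F := F) (p := 2) (p' := 6) one_le_two
    (by rw [h3]; norm_num) (by rw [h3]; norm_num) hθ0 hθ1
  refine ⟨C, fun x₀ ρ hρ f hf hf2 hDf2 => ?_⟩
  have hw : HasWeakFDerivOn (shell x₀ (θ * ρ) ρ) volume f (fderiv ℝ f) :=
    HasWeakFDerivOn.of_contDiff_holds _ volume hf
  have hsob : MemSobolevDomain 1 ((2 : ℝ≥0) : ℝ≥0∞) (shell x₀ (θ * ρ) ρ) volume f := by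
    refine memSobolevDomain_succ_iff.2 ⟨by exact_mod_cast hf2, fderiv ℝ f, hw, fun v => ?_⟩
    rw [memSobolevDomain_zero_iff]
    exact_mod_cast (ContinuousLinearMap.apply ℝ F v).comp_memLp' hDf2
  exact_mod_cast hC x₀ ρ hρ f (fderiv ℝ f) hsob hw

end Literature.Analysis.FunctionSpaces

end
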